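import Summits.QuantumFields.YangMills.Theorems.FluctuationComparisonRegPrIntLWregGlue
import HarnessLib

/-!
# THE IDENTITY ROW (ID) OF THE TWO-GAS PACKAGE FROM THE ENGINE HAND'S CURRENCIES (G16, px10 lineage, FILE H): ★★ `heightDensity_mul_ae_eq_of_fineWeakForm`
# (FINE-LATTICE WEAK FORM ⟹ the a.e. identity), ★ `mul_ae_eq_mul_of_common_factor` (PRODUCT FORM ⟹ the cross identity), ★★ `heightDensity_ae_eq_fibreInt_of_subset` ∕
# ★★ `heightDensity_mul_ae_eq_of_fibreInt` (WINDOW-CHART FIBRE INTEGRALS ⟹ the a.e. identity) — generic in the two events and the two factors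

Cell `ym3-torus` (HUMAN RULING D-0037: rung R3 = continuum `SU(2)` Yang–Mills on `T³` — NOT `d = 4`, NOT infinite volume, NOT a mass gap, NOT the Clay problem); width seat
`ym3-torus-px10` (gen 19); helper of the crux `stmt-QuantumFields-20520` `UnitScaleTilt.FluctuationComparisonRegPrIntL` (`--supports … --as helper`, NOT a proof of it).
THEOREMS ONLY: 0 `def`, 0 `instance`, 0 `notation`, 0 `sorry`, default heartbeats.  Option (b) of px10 g18's ■ FINAL (★★OWNER g41 №296 docket).

WHY.  By ✓`…LargeFieldGasOfTwoGasPackage.largeFieldFourPtIntCan_of_twoGasPackage` (FILE E, RECORD 17gf) the registered `stub_largeFieldFourPtIntCan` rests on the TWO-GAS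
PACKAGE `h2P` alone, whose one non-bookkeeping row at `(J, K)` is THE UNNORMALISED IDENTITY (ID): per deep history `Q`, `dU_J`-a.e. on the window `W`,
`ρ(E_Q)·Ξ_v(Λ) = ρ(E_∅)·Σ_S (Π h₂)·Ξ_v(vacCompat Λ S)`, where `ρ(E) = heightDensity F γ hJK E` is the Radon–Nikodym tower `T_{K−J−1}⋯T_0(1_E e^{−β_K A})` read at height
`K − J` (lit `T3TiltDescent.heightDensity`, `T3RestrictedUnitDensity.resDensity`) — an `L¹` class, not a function.  The hand that proves (ID) ([Balaban1985UV3] Thm 2 (43)–(47):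
the expansion of the fibre integrals `∫_{fibre(U)} 1_{E} e^{−β_K A}` after a gauge-fixed chart) never meets that tower: it computes FINE-LATTICE integrals (Fubini in the chart)
or FIBRE integrals (the chart's Jacobian face).  This file supplies the three doors from those currencies to the a.e. row, for ARBITRARY measurable fine events `E₁, E₀` and
ARBITRARY factors `A, B` (so they survive any re-cut of `h2P`'s locality rows, CURRENCY CAVEAT №229):
* §1 (generic measure theory) ★`ae_eq_mul_of_forall_integral_indicator_mul_eq`: two integrable real densities `ρ₁, ρ₀`, two measurable complex factors `A, B`, a measurable
  `W`; if `∫ ρ₁·1_T A = ∫ ρ₀·1_T B` for every measurable `T ⊆ W` ON WHICH `A` AND `B` ARE BOUNDED, then `ρ₁·A = ρ₀·B` a.e. on `W` (Bochner uniqueness on the truncations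
  `W ∩ {‖A‖,‖B‖ ≤ n}`, `ae_all_iff`) — the truncation clause is what lets UNBOUNDED continuous gases `Ξ_v` on an OPEN window through; real edition `…_real`.
* §2 ★`integral_heightDensity_mul_complex` — ✓`LogComparisonOneTower.integral_heightDensity_mul` ([Balaban1985Averaging] (10) iterated: `∫ ρ(E)·g dU_J = ∫_E e^{−β_K A}·(g ∘ D) dV_K`,
  `D = descendTo`) for bounded measurable COMPLEX tests; ★★`heightDensity_mul_ae_eq_of_fineWeakForm`: the FINE-LATTICE WEAK FORM «∀ measurable `T ⊆ W` on which `A, B` are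
  bounded: `∫_{E₁} e^{−β_K A}·(1_T A)(D V) dV_K = ∫_{E₀} e^{−β_K A}·(1_T B)(D V) dV_K`» ⟹ `ρ(E₁)·A = ρ(E₀)·B` a.e. on `W`; ★`…_of_continuousOn` — the same with `A, B` merely
  continuous on an OPEN `W` (the package's rows (vc)∕(hc) give exactly that).
* §3 ★`mul_ae_eq_mul_of_common_factor`: a common normalisation `N` with `ρ(E₁) = N·A₁`, `ρ(E₀) = N·A₀` a.e. on `W` ⟹ `ρ(E₁)·A₀ = ρ(E₀)·A₁` a.e. on `W` — why (ID) carries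
  `Ξ_v(Λ)` on the left: the Gaussian normalisation of [Balaban1985UV3] (22)∕(35) is the SAME for `E_Q` and `E_∅` and is never named.
* §4 ★★`heightDensity_ae_eq_fibreInt_of_subset`: for a ✓`WindowChart c` of `descendTo` on `Sfine` over an open `O` ([Balaban1987RG1] (2.10)) and EVERY measurable sub-event
  `E ⊆ Sfine`: `ρ(E)(V) = ∫ jac(V,z)·1_E(Φ(V,z))·e^{−β_K A(Φ(V,z))} dz` for a.e. `V ∈ O` (sub-event edition of ✓`heightDensityCan_eq_fibreInt`, which needs the fibre integral
  continuous — false for a sharp large-field event; the a.e. form asks nothing), by ✓`Node00.integral_mul_comp_eq_integral_fibreIntegral_mul_of_ne_zero` +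
  ✓`Node00.ae_eq_restrict_of_forall_integral_mul_eq`; ★★`heightDensity_mul_ae_eq_of_fibreInt`: hence (ID)-shaped rows a.e. on `O` ⟸ the PER-DATUM identity of explicit
  fibre integrals on `O`, for any two measurable sub-events of the charted set.

HONEST — WHAT THIS IS NOT.  Doors (measure theory); no expansion, no chart constructed (the tree's ✓`…WregAssembly.nonempty_chartData` charts the `chainWindow`-charted set
`⊇ histGood`; whether a large-field event `histEvent Q` lies in a charted set is NOT settled here), nothing of Bałaban's analysis.  The two-gas package `h2P`, LF-INT∘,
`stub_largeFieldFourPtIntCan`, S2β, the crux 20520 NOT proved; `YM3TorusSU2` NOT proved; finite volume ∕ conditional; the Yang–Mills mass gap (Clay) NOT proved; rung R3 =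
YM₃ on `T³` — NOT `d = 4`, NOT infinite volume, NOT a mass gap.
References: [Balaban1985UV3] T. Bałaban, CMP 102 (1985): (2) p.256, (6)–(7) p.257, (22) p.261, (35) p.265, (41) p.266, Thm 2 (43)–(47) pp.266–267; [Balaban1985Averaging]
CMP 98 (1985) (10) p.19; [Balaban1987RG1] CMP 109 (1987) (0.13) p.254, (2.10) p.267.
-/

set_option autoImplicit false

noncomputable section

open MeasureTheory Filter Topology Set
open scoped ENNReal NNReal
open Literature.MathematicalPhysics.QuantumFieldTheory.Balaban1983to89
open Literature.MathematicalPhysics.QuantumFieldTheory.Balaban1983to89.T3ContinuumYM3Torus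
open Literature.MathematicalPhysics.QuantumFieldTheory.Balaban1983to89.T3NestedUnitLaws
open Literature.MathematicalPhysics.QuantumFieldTheory.Balaban1983to89.T3UnitLawDensityEML
open Literature.MathematicalPhysics.QuantumFieldTheory.Balaban1983to89.T3UnitScaleTilt
open Literature.MathematicalPhysics.QuantumFieldTheory.Balaban1983to89.T3TiltDescent
open Literature.MathematicalPhysics.QuantumFieldTheory.Balaban1983to89.T3LevelShift
open Literature.MathematicalPhysics.QuantumFieldTheory.Balaban1983to89.Missing
open Literature.MathematicalPhysics.QuantumFieldTheory.Balaban1983to89.T4Continuum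
open scoped Literature.MathematicalPhysics.QuantumFieldTheory.Balaban1983to89.T3OrbitAverage
open Summit.QuantumFields.YangMills.Theorems.FluctuationComparisonRegPrIntLWregGlue (WindowChart rho_props)

namespace Summit.QuantumFields.YangMills.Theorems.FluctuationComparisonRegPrIntLLargeFieldGasIdentityOfWeakForm

/-! ## §1 Generic: an a.e. identity of two weighted densities on `W` from its integrals against truncated tests -/

section Generic

variable {X : Type*} [MeasurableSpace X] {μ : Measure X}

/-- ★ **A.E. IDENTITY FROM TRUNCATED TESTS** (complex factors): if `∫ ρ₁·1_T·A = ∫ ρ₀·1_T·B` for every measurable `T ⊆ W` on which `A` and `B` are bounded, then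
`ρ₁·A = ρ₀·B` `μ`-a.e. on `W` (Bochner uniqueness on the truncations `W ∩ {‖A‖ ≤ n, ‖B‖ ≤ n}`, exhausting `W`). [cite: Balaban1987RG1, (0.13) p.254 (bookkeeping)] -/
theorem ae_eq_mul_of_forall_integral_indicator_mul_eq {ρ₁ ρ₀ : X → ℝ} (h₁ : Integrable ρ₁ μ) (h₀ : Integrable ρ₀ μ)
    {A B : X → ℂ} (hA : Measurable A) (hB : Measurable B) {W : Set X} (hW : MeasurableSet W)
    (h : ∀ T ⊆ W, MeasurableSet T → (∃ C : ℝ, ∀ x ∈ T, ‖A x‖ ≤ C ∧ ‖B x‖ ≤ C) →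
      ∫ x, (ρ₁ x : ℂ) * T.indicator A x ∂μ = ∫ x, (ρ₀ x : ℂ) * T.indicator B x ∂μ) :
    ∀ᵐ x ∂μ, x ∈ W → (ρ₁ x : ℂ) * A x = (ρ₀ x : ℂ) * B x := by
  -- on each truncation the two products are integrable and have the same set integrals
  have key : ∀ n : ℕ, ∀ᵐ x ∂μ, x ∈ W → ‖A x‖ ≤ n → ‖B x‖ ≤ n → (ρ₁ x : ℂ) * A x = (ρ₀ x : ℂ) * B x := by
    intro n
    set Wn : Set X := W ∩ {x | ‖A x‖ ≤ n ∧ ‖B x‖ ≤ n} with hWn_def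
    have hWn : MeasurableSet Wn :=
      hW.inter ((measurableSet_le hA.norm measurable_const).inter (measurableSet_le hB.norm measurable_const))
    have hbA : ∀ x, ‖Wn.indicator A x‖ ≤ n := fun x => by
      by_cases hx : x ∈ Wn
      · rw [Set.indicator_of_mem hx]; exact hx.2.1
      · rw [Set.indicator_of_notMem hx, norm_zero]; exact Nat.cast_nonneg n
    have hbB : ∀ x, ‖Wn.indicator B x‖ ≤ n := fun x => by
      by_cases hx : x ∈ Wn
      · rw [Set.indicator_of_mem hx]; exact hx.2.2
      · rw [Set.indicator_of_notMem hx, norm_zero]; exact Nat.cast_nonneg n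
    have hg₁ : Integrable (fun x => (ρ₁ x : ℂ) * Wn.indicator A x) μ :=
      h₁.ofReal.mul_bdd (hA.indicator hWn).aestronglyMeasurable (Eventually.of_forall hbA)
    have hg₀ : Integrable (fun x => (ρ₀ x : ℂ) * Wn.indicator B x) μ :=
      h₀.ofReal.mul_bdd (hB.indicator hWn).aestronglyMeasurable (Eventually.of_forall hbB)
    have hae : (fun x => (ρ₁ x : ℂ) * Wn.indicator A x) =ᵐ[μ] (fun x => (ρ₀ x : ℂ) * Wn.indicator B x) := by
      refine Integrable.ae_eq_of_forall_setIntegral_eq _ _ hg₁ hg₀ fun s hs _ => ?_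
      rw [← integral_indicator hs, ← integral_indicator hs]
      have e₁ : s.indicator (fun x => (ρ₁ x : ℂ) * Wn.indicator A x) = fun x => (ρ₁ x : ℂ) * (s ∩ Wn).indicator A x := by
        funext x
        rw [Set.indicator_mul_right, Set.indicator_indicator]
      have e₀ : s.indicator (fun x => (ρ₀ x : ℂ) * Wn.indicator B x) = fun x => (ρ₀ x : ℂ) * (s ∩ Wn).indicator B x := by
        funext x
        rw [Set.indicator_mul_right, Set.indicator_indicator]
      rw [e₁, e₀]
      exact h (s ∩ Wn) (fun x hx => hx.2.1) (hs.inter hWn) ⟨n, fun x hx => hx.2.2⟩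
    filter_upwards [hae] with x hx hxW hxA hxB
    have hxWn : x ∈ Wn := ⟨hxW, hxA, hxB⟩
    simpa only [Set.indicator_of_mem hxWn] using hx
  have hall : ∀ᵐ x ∂μ, ∀ n : ℕ, x ∈ W → ‖A x‖ ≤ n → ‖B x‖ ≤ n → (ρ₁ x : ℂ) * A x = (ρ₀ x : ℂ) * B x :=
    ae_all_iff.mpr key
  filter_upwards [hall] with x hx hxW
  obtain ⟨n, hn⟩ := exists_nat_ge (max ‖A x‖ ‖B x‖)
  exact hx n hxW ((le_max_left _ _).trans hn) ((le_max_right _ _).trans hn)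

/-- Real edition of ★`ae_eq_mul_of_forall_integral_indicator_mul_eq`. [cite: Balaban1987RG1, (0.13) p.254 (bookkeeping)] -/
theorem ae_eq_mul_of_forall_integral_indicator_mul_eq_real {ρ₁ ρ₀ : X → ℝ} (h₁ : Integrable ρ₁ μ) (h₀ : Integrable ρ₀ μ)
    {A B : X → ℝ} (hA : Measurable A) (hB : Measurable B) {W : Set X} (hW : MeasurableSet W)
    (h : ∀ T ⊆ W, MeasurableSet T → (∃ C : ℝ, ∀ x ∈ T, |A x| ≤ C ∧ |B x| ≤ C) →
      ∫ x, ρ₁ x * T.indicator A x ∂μ = ∫ x, ρ₀ x * T.indicator B x ∂μ) :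
    ∀ᵐ x ∂μ, x ∈ W → ρ₁ x * A x = ρ₀ x * B x := by
  have hA' : Measurable fun x => (A x : ℂ) := Complex.measurable_ofReal.comp hA
  have hB' : Measurable fun x => (B x : ℂ) := Complex.measurable_ofReal.comp hB
  have hind : ∀ (T : Set X) (f : X → ℝ) (x : X), T.indicator (fun y => (f y : ℂ)) x = ((T.indicator f x : ℝ) : ℂ) := fun T f x => by
    by_cases hx : x ∈ T
    · rw [Set.indicator_of_mem hx, Set.indicator_of_mem hx]
    · rw [Set.indicator_of_notMem hx, Set.indicator_of_notMem hx, Complex.ofReal_zero]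
  have hc := ae_eq_mul_of_forall_integral_indicator_mul_eq (μ := μ) h₁ h₀ hA' hB' hW fun T hTW hT hC => by
    obtain ⟨C, hC⟩ := hC
    have hC' : ∃ C : ℝ, ∀ x ∈ T, |A x| ≤ C ∧ |B x| ≤ C :=
      ⟨C, fun x hx => ⟨by simpa only [Complex.norm_real, Real.norm_eq_abs] using (hC x hx).1,
        by simpa only [Complex.norm_real, Real.norm_eq_abs] using (hC x hx).2⟩⟩
    have key := h T hTW hT hC'
    simp only [hind, ← Complex.ofReal_mul, integral_complex_ofReal, key]
  filter_upwards [hc] with x hx hxW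
  exact_mod_cast hx hxW

/-- ★ **PRODUCT FORM ⟹ CROSS IDENTITY**: a common normalisation `N` with `ρ₁ = N·A₁` and `ρ₀ = N·A₀` a.e. on `W` gives `ρ₁·A₀ = ρ₀·A₁` a.e. on `W` — the
normalisation is never named. [cite: Balaban1985UV3, (22) p.261 and (35) p.265 (bookkeeping)] -/
theorem mul_ae_eq_mul_of_common_factor {W : Set X} {ρ₁ ρ₀ N A₁ A₀ : X → ℂ}
    (h₁ : ∀ᵐ x ∂μ, x ∈ W → ρ₁ x = N x * A₁ x) (h₀ : ∀ᵐ x ∂μ, x ∈ W → ρ₀ x = N x * A₀ x) :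
    ∀ᵐ x ∂μ, x ∈ W → ρ₁ x * A₀ x = ρ₀ x * A₁ x := by
  filter_upwards [h₁, h₀] with x hx₁ hx₀ hxW
  rw [hx₁ hxW, hx₀ hxW]
  ring

/-- Pointwise edition of ★`mul_ae_eq_mul_of_common_factor` (identities holding at every point of `W`). [cite: Balaban1985UV3, (22) p.261 and (35) p.265 (bookkeeping)] -/
theorem mul_ae_eq_mul_of_common_factor_on {W : Set X} {ρ₁ ρ₀ N A₁ A₀ : X → ℂ}
    (h₁ : ∀ x ∈ W, ρ₁ x = N x * A₁ x) (h₀ : ∀ x ∈ W, ρ₀ x = N x * A₀ x) :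
    ∀ᵐ x ∂μ, x ∈ W → ρ₁ x * A₀ x = ρ₀ x * A₁ x :=
  mul_ae_eq_mul_of_common_factor (Eventually.of_forall h₁) (Eventually.of_forall h₀)

end Generic

/-! ## §2 The fine-lattice weak form of the restricted height densities, complex tests; the weak-form door -/

section Tower

variable (F : T3Family) {γ : ℝ} {J K : ℕ} (hJK : J ≤ K)

/-- ★ **(2)∕(6) WITH A COMPLEX TEST**: `∫ ρ(E)(V)·g(V) dU_J = ∫_E e^{−β_K A(U)}·g(D U) dV_K` for bounded measurable `g : fields → ℂ` (real and imaginary parts through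
✓`LogComparisonOneTower.integral_heightDensity_mul`). [cite: Balaban1985Averaging, (10) p.19; Balaban1985UV3, (2) p.256 and (6) p.257] -/
theorem integral_heightDensity_mul_complex (hγ : 0 ≤ γ) {S : Set (GaugeField (F.P K) 0 (Matrix.specialUnitaryGroup (Fin 2) ℂ))}
    (hS : MeasurableSet S) (g : GaugeField (F.P J) 0 (Matrix.specialUnitaryGroup (Fin 2) ℂ) → ℂ) (hg : Measurable g) (hC : ∃ C : ℝ, ∀ V, ‖g V‖ ≤ C) :
    ∫ V, (heightDensity F γ hJK S V : ℂ) * g V ∂fieldMeasure (F.P J) 0 (Matrix.specialUnitaryGroup (Fin 2) ℂ) =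
      ∫ U, ((S.indicator (boltzmann (F.P K) ((F.scheme ℰp γ).β K)) U : ℝ) : ℂ) * g (descendTo F ℰp J K hJK U)
        ∂fieldMeasure (F.P K) 0 (Matrix.specialUnitaryGroup (Fin 2) ℂ) := by
  obtain ⟨C, hC⟩ := hC
  obtain ⟨hρm, hρi⟩ := heightDensity_props F hJK hS hγ
  have hβ : 0 ≤ (F.scheme ℰp γ).β K := F.scheme_β_nonneg ℰp hγ K
  obtain ⟨hbm, hbi, -, -, -⟩ := rho_props (F := F) (K := K) (Sfine := S) hS hβ
  have hD := measurable_descendTo F ℰp measurableE_ℰp hJK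
  -- the two real identities
  have hre := Summit.QuantumFields.YangMills.Theorems.LogComparisonOneTower.integral_heightDensity_mul F K hJK hγ hS (fun V => (g V).re)
    (Complex.measurable_re.comp hg) ⟨C, fun V => (Complex.abs_re_le_norm _).trans (hC V)⟩
  have him := Summit.QuantumFields.YangMills.Theorems.LogComparisonOneTower.integral_heightDensity_mul F K hJK hγ hS (fun V => (g V).im)
    (Complex.measurable_im.comp hg) ⟨C, fun V => (Complex.abs_im_le_norm _).trans (hC V)⟩
  -- integrability of the two complex integrands
  have hI₁ : Integrable (fun V => (heightDensity F γ hJK S V : ℂ) * g V) (fieldMeasure (F.P J) 0 (Matrix.specialUnitaryGroup (Fin 2) ℂ)) :=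
    hρi.ofReal.mul_bdd hg.aestronglyMeasurable (Eventually.of_forall hC)
  have hI₀ : Integrable (fun U => ((S.indicator (boltzmann (F.P K) ((F.scheme ℰp γ).β K)) U : ℝ) : ℂ) * g (descendTo F ℰp J K hJK U))
      (fieldMeasure (F.P K) 0 (Matrix.specialUnitaryGroup (Fin 2) ℂ)) :=
    hbi.ofReal.mul_bdd (hg.comp hD).aestronglyMeasurable (Eventually.of_forall fun U => hC _)
  rw [← integral_re_add_im hI₁, ← integral_re_add_im hI₀]
  simp only [RCLike.re_to_complex, RCLike.im_to_complex, RCLike.I_to_complex, Complex.re_ofReal_mul, Complex.im_ofReal_mul]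
  rw [hre, him]

/-- ★★ **THE WEAK-FORM DOOR**: if for every measurable `T ⊆ W` on which `A` and `B` are bounded the FINE-LATTICE identity
`∫_{E₁} e^{−β_K A}·(1_T·A)(D V) dV_K = ∫_{E₀} e^{−β_K A}·(1_T·B)(D V) dV_K` holds, then `ρ(E₁)·A = ρ(E₀)·B` `dU_J`-a.e. on `W` (`ρ = heightDensity`, `D = descendTo`;
`E₁, E₀` measurable fine events, `A, B` measurable complex factors, `γ ≥ 0`). [cite: Balaban1985UV3, (2) p.256, (6)-(7) p.257 and (43)-(47) pp.266-267] -/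
theorem heightDensity_mul_ae_eq_of_fineWeakForm (hγ : 0 ≤ γ)
    {E₁ E₀ : Set (GaugeField (F.P K) 0 (Matrix.specialUnitaryGroup (Fin 2) ℂ))} (hE₁ : MeasurableSet E₁) (hE₀ : MeasurableSet E₀)
    {W : Set (GaugeField (F.P J) 0 (Matrix.specialUnitaryGroup (Fin 2) ℂ))} (hW : MeasurableSet W)
    {A B : GaugeField (F.P J) 0 (Matrix.specialUnitaryGroup (Fin 2) ℂ) → ℂ} (hA : Measurable A) (hB : Measurable B)
    (h : ∀ T ⊆ W, MeasurableSet T → (∃ C : ℝ, ∀ V ∈ T, ‖A V‖ ≤ C ∧ ‖B V‖ ≤ C) →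
      ∫ U, ((E₁.indicator (boltzmann (F.P K) ((F.scheme ℰp γ).β K)) U : ℝ) : ℂ) * T.indicator A (descendTo F ℰp J K hJK U)
          ∂fieldMeasure (F.P K) 0 (Matrix.specialUnitaryGroup (Fin 2) ℂ) =
        ∫ U, ((E₀.indicator (boltzmann (F.P K) ((F.scheme ℰp γ).β K)) U : ℝ) : ℂ) * T.indicator B (descendTo F ℰp J K hJK U)
          ∂fieldMeasure (F.P K) 0 (Matrix.specialUnitaryGroup (Fin 2) ℂ)) :
    ∀ᵐ V ∂fieldMeasure (F.P J) 0 (Matrix.specialUnitaryGroup (Fin 2) ℂ), V ∈ W →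
      (heightDensity F γ hJK E₁ V : ℂ) * A V = (heightDensity F γ hJK E₀ V : ℂ) * B V := by
  refine ae_eq_mul_of_forall_integral_indicator_mul_eq (heightDensity_props F hJK hE₁ hγ).2 (heightDensity_props F hJK hE₀ hγ).2 hA hB hW
    fun T hTW hT hC => ?_
  obtain ⟨C, hC⟩ := hC
  have hbdA : ∃ C' : ℝ, ∀ V, ‖T.indicator A V‖ ≤ C' := ⟨|C|, fun V => by
    by_cases hV : V ∈ T
    · rw [Set.indicator_of_mem hV]; exact (hC V hV).1.trans (le_abs_self C)
    · rw [Set.indicator_of_notMem hV, norm_zero]; exact abs_nonneg C⟩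
  have hbdB : ∃ C' : ℝ, ∀ V, ‖T.indicator B V‖ ≤ C' := ⟨|C|, fun V => by
    by_cases hV : V ∈ T
    · rw [Set.indicator_of_mem hV]; exact (hC V hV).2.trans (le_abs_self C)
    · rw [Set.indicator_of_notMem hV, norm_zero]; exact abs_nonneg C⟩
  rw [integral_heightDensity_mul_complex F hJK hγ hE₁ _ (hA.indicator hT) hbdA,
    integral_heightDensity_mul_complex F hJK hγ hE₀ _ (hB.indicator hT) hbdB]
  exact h T hTW hT ⟨C, hC⟩

/-- ★ **THE WEAK-FORM DOOR, CONTINUOUS FACTORS ON AN OPEN WINDOW**: the same with `A, B` only continuous on the open `W` (the two-gas package's rows (vc)∕(hc): activities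
continuous on the window; a finite gas `Ξ_v` is then continuous there and in general UNBOUNDED near `∂W` — whence the truncation clause).
[cite: Balaban1985UV3, (2) p.256, (6)-(7) p.257 and (43)-(47) pp.266-267; Balaban1989LargeFieldII, p.390] -/
theorem heightDensity_mul_ae_eq_of_fineWeakForm_of_continuousOn (hγ : 0 ≤ γ)
    {E₁ E₀ : Set (GaugeField (F.P K) 0 (Matrix.specialUnitaryGroup (Fin 2) ℂ))} (hE₁ : MeasurableSet E₁) (hE₀ : MeasurableSet E₀)
    {W : Set (GaugeField (F.P J) 0 (Matrix.specialUnitaryGroup (Fin 2) ℂ))} (hW : IsOpen W)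
    {A B : GaugeField (F.P J) 0 (Matrix.specialUnitaryGroup (Fin 2) ℂ) → ℂ} (hA : ContinuousOn A W) (hB : ContinuousOn B W)
    (h : ∀ T ⊆ W, MeasurableSet T → (∃ C : ℝ, ∀ V ∈ T, ‖A V‖ ≤ C ∧ ‖B V‖ ≤ C) →
      ∫ U, ((E₁.indicator (boltzmann (F.P K) ((F.scheme ℰp γ).β K)) U : ℝ) : ℂ) * T.indicator A (descendTo F ℰp J K hJK U)
          ∂fieldMeasure (F.P K) 0 (Matrix.specialUnitaryGroup (Fin 2) ℂ) =
        ∫ U, ((E₀.indicator (boltzmann (F.P K) ((F.scheme ℰp γ).β K)) U : ℝ) : ℂ) * T.indicator B (descendTo F ℰp J K hJK U)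
          ∂fieldMeasure (F.P K) 0 (Matrix.specialUnitaryGroup (Fin 2) ℂ)) :
    ∀ᵐ V ∂fieldMeasure (F.P J) 0 (Matrix.specialUnitaryGroup (Fin 2) ℂ), V ∈ W →
      (heightDensity F γ hJK E₁ V : ℂ) * A V = (heightDensity F γ hJK E₀ V : ℂ) * B V := by
  classical
  -- the measurable extensions by zero
  have hA' : Measurable (W.indicator A) := by
    rw [← Set.piecewise_eq_indicator]; exact hA.measurable_piecewise continuousOn_const hW.measurableSet
  have hB' : Measurable (W.indicator B) := by
    rw [← Set.piecewise_eq_indicator]; exact hB.measurable_piecewise continuousOn_const hW.measurableSet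
  have hTA : ∀ T ⊆ W, T.indicator (W.indicator A) = T.indicator A := fun T hT => by
    rw [Set.indicator_indicator, Set.inter_eq_self_of_subset_left hT]
  have hTB : ∀ T ⊆ W, T.indicator (W.indicator B) = T.indicator B := fun T hT => by
    rw [Set.indicator_indicator, Set.inter_eq_self_of_subset_left hT]
  have key := heightDensity_mul_ae_eq_of_fineWeakForm F hJK hγ hE₁ hE₀ hW.measurableSet hA' hB' fun T hTW hT hC => by
    obtain ⟨C, hC⟩ := hC
    rw [hTA T hTW, hTB T hTW]
    exact h T hTW hT ⟨C, fun V hV => by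
      have := hC V hV
      rwa [Set.indicator_of_mem (hTW hV), Set.indicator_of_mem (hTW hV)] at this⟩
  filter_upwards [key] with V hV hVW
  simpa only [Set.indicator_of_mem hVW] using hV hVW

end Tower

/-! ## §4 Window-chart fibre integrals: the a.e. chart formula for every measurable sub-event, and the fibre-integral door -/

section Chart

variable {F : T3Family} {J K : ℕ} {hJK : J ≤ K} {Sfine : Set (GaugeField (F.P K) 0 (Matrix.specialUnitaryGroup (Fin 2) ℂ))}
  {O : Set (GaugeField (F.P J) 0 (Matrix.specialUnitaryGroup (Fin 2) ℂ))}

/-- ★★ **THE RESTRICTED DENSITY OF A SUB-EVENT IN CHART COORDINATES, A.E.**: for a window chart `c` of `descendTo` on `Sfine` over the open `O` and every measurable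
`E ⊆ Sfine`, `ρ(E)(V) = ∫ jac(V,z)·1_E(Φ(V,z))·e^{−β_K A(Φ(V,z))} dz` for `dU_J`-a.e. `V ∈ O` (`γ′ ≥ 0`).  Sub-event edition of ✓`heightDensityCan_eq_fibreInt` without the
continuity that a sharp event would break. [cite: Balaban1987RG1, (2.10) p.267 and (0.13) p.254; Balaban1985UV3, (7) p.257] -/
theorem heightDensity_ae_eq_fibreInt_of_subset (c : WindowChart F hJK Sfine O) (hO : IsOpen O) {γ' : ℝ} (hγ' : 0 ≤ γ')
    {E : Set (GaugeField (F.P K) 0 (Matrix.specialUnitaryGroup (Fin 2) ℂ))} (hE : MeasurableSet E) (hEs : E ⊆ Sfine) :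
    ∀ᵐ V ∂fieldMeasure (F.P J) 0 (Matrix.specialUnitaryGroup (Fin 2) ℂ), V ∈ O →
      heightDensity F γ' hJK E V = ∫ z, (c.jac (V, z) : ℝ) * E.indicator (boltzmann (F.P K) ((F.scheme ℰp γ').β K)) (c.Φ (V, z))
        ∂fieldMeasure (F.P K) 0 (Matrix.specialUnitaryGroup (Fin 2) ℂ) := by
  have hβ : 0 ≤ (F.scheme ℰp γ').β K := F.scheme_β_nonneg ℰp hγ' K
  obtain ⟨-, hρi, -, -, hρS⟩ := rho_props (F := F) (K := K) (Sfine := E) hE hβ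
  have havg := measurable_descendTo F ℰp measurableE_ℰp hJK
  have hT : IntegrableOn (heightDensity F γ' hJK E) O (fieldMeasure (F.P J) 0 (Matrix.specialUnitaryGroup (Fin 2) ℂ)) :=
    (heightDensity_props F hJK hE hγ').2.integrableOn
  have hg := Node00.integrableOn_fibreIntegral_of_fibredChart c.measurable_Φ c.measurable_jac c.map_Φ hρi
  have hae := Node00.ae_eq_restrict_of_forall_integral_mul_eq hO.measurableSet hT hg fun f hf hC hf0 =>
    (Summit.QuantumFields.YangMills.Theorems.LogComparisonOneTower.integral_heightDensity_mul F K hJK hγ' hE f hf hC).trans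
      (Node00.integral_mul_comp_eq_integral_fibreIntegral_mul_of_ne_zero hO.measurableSet havg c.measurable_Φ c.measurable_jac
        c.descendTo_Φ c.map_Φ hρi (fun x hx => hEs (hρS x hx)) hf hC hf0)
  exact (ae_restrict_iff' hO.measurableSet).mp hae

/-- ★★ **THE FIBRE-INTEGRAL DOOR**: for two measurable sub-events `E₁, E₀ ⊆ Sfine` of the charted set and any factors `A, B`, the PER-DATUM identity on `O`
`(∫ jac·1_{E₁}(Φ)·e^{−β_K A(Φ)} dz)·A(V) = (∫ jac·1_{E₀}(Φ)·e^{−β_K A(Φ)} dz)·B(V)` gives `ρ(E₁)·A = ρ(E₀)·B` `dU_J`-a.e. on `O`.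
[cite: Balaban1987RG1, (2.10) p.267; Balaban1985UV3, Thm 2 (43)-(47) pp.266-267] -/
theorem heightDensity_mul_ae_eq_of_fibreInt (c : WindowChart F hJK Sfine O) (hO : IsOpen O) {γ' : ℝ} (hγ' : 0 ≤ γ')
    {E₁ E₀ : Set (GaugeField (F.P K) 0 (Matrix.specialUnitaryGroup (Fin 2) ℂ))} (hE₁ : MeasurableSet E₁) (hE₀ : MeasurableSet E₀)
    (hE₁s : E₁ ⊆ Sfine) (hE₀s : E₀ ⊆ Sfine) {A B : GaugeField (F.P J) 0 (Matrix.specialUnitaryGroup (Fin 2) ℂ) → ℂ}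
    (h : ∀ V ∈ O,
      ((∫ z, (c.jac (V, z) : ℝ) * E₁.indicator (boltzmann (F.P K) ((F.scheme ℰp γ').β K)) (c.Φ (V, z))
          ∂fieldMeasure (F.P K) 0 (Matrix.specialUnitaryGroup (Fin 2) ℂ) : ℝ) : ℂ) * A V =
      ((∫ z, (c.jac (V, z) : ℝ) * E₀.indicator (boltzmann (F.P K) ((F.scheme ℰp γ').β K)) (c.Φ (V, z))
          ∂fieldMeasure (F.P K) 0 (Matrix.specialUnitaryGroup (Fin 2) ℂ) : ℝ) : ℂ) * B V) :
    ∀ᵐ V ∂fieldMeasure (F.P J) 0 (Matrix.specialUnitaryGroup (Fin 2) ℂ), V ∈ O →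
      (heightDensity F γ' hJK E₁ V : ℂ) * A V = (heightDensity F γ' hJK E₀ V : ℂ) * B V := by
  filter_upwards [heightDensity_ae_eq_fibreInt_of_subset c hO hγ' hE₁ hE₁s, heightDensity_ae_eq_fibreInt_of_subset c hO hγ' hE₀ hE₀s]
    with V h₁ h₀ hVO
  rw [h₁ hVO, h₀ hVO]
  exact h V hVO

/-- ★ **FIBRE PRODUCT FORM ⟹ THE A.E. ROW**: if on `O` both fibre integrals factor through a common `N` — `∫ jac·1_{E₁}(Φ)·e^{−βA(Φ)} = N·A₁`, `∫ jac·1_{E₀}(Φ)·e^{−βA(Φ)} = N·A₀`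
(the expansion's Gaussian normalisation times the two gases) — then `ρ(E₁)·A₀ = ρ(E₀)·A₁` `dU_J`-a.e. on `O`. [cite: Balaban1985UV3, (22) p.261, (35) p.265 and Thm 2 (43)-(47) pp.266-267] -/
theorem heightDensity_mul_ae_eq_of_fibreInt_productForm (c : WindowChart F hJK Sfine O) (hO : IsOpen O) {γ' : ℝ} (hγ' : 0 ≤ γ')
    {E₁ E₀ : Set (GaugeField (F.P K) 0 (Matrix.specialUnitaryGroup (Fin 2) ℂ))} (hE₁ : MeasurableSet E₁) (hE₀ : MeasurableSet E₀)
    (hE₁s : E₁ ⊆ Sfine) (hE₀s : E₀ ⊆ Sfine) {N A₁ A₀ : GaugeField (F.P J) 0 (Matrix.specialUnitaryGroup (Fin 2) ℂ) → ℂ}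
    (h₁ : ∀ V ∈ O, ((∫ z, (c.jac (V, z) : ℝ) * E₁.indicator (boltzmann (F.P K) ((F.scheme ℰp γ').β K)) (c.Φ (V, z))
          ∂fieldMeasure (F.P K) 0 (Matrix.specialUnitaryGroup (Fin 2) ℂ) : ℝ) : ℂ) = N V * A₁ V)
    (h₀ : ∀ V ∈ O, ((∫ z, (c.jac (V, z) : ℝ) * E₀.indicator (boltzmann (F.P K) ((F.scheme ℰp γ').β K)) (c.Φ (V, z))
          ∂fieldMeasure (F.P K) 0 (Matrix.specialUnitaryGroup (Fin 2) ℂ) : ℝ) : ℂ) = N V * A₀ V) :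
    ∀ᵐ V ∂fieldMeasure (F.P J) 0 (Matrix.specialUnitaryGroup (Fin 2) ℂ), V ∈ O →
      (heightDensity F γ' hJK E₁ V : ℂ) * A₀ V = (heightDensity F γ' hJK E₀ V : ℂ) * A₁ V :=
  heightDensity_mul_ae_eq_of_fibreInt c hO hγ' hE₁ hE₀ hE₁s hE₀s fun V hV => by rw [h₁ V hV, h₀ V hV]; ring

end Chart

end Summit.QuantumFields.YangMills.Theorems.FluctuationComparisonRegPrIntLLargeFieldGasIdentityOfWeakForm

end
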